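import Summits.QuantumFields.BalabanUV.Beta.SymmetrisedDressingMatrix

/-!
# `BalabanUV.Beta.SymmetrisedDressingKernel` — binder row D1, JSB12SYM-SPINE v1.1 (Σ2) step K1-a part 2: THE SYMMETRISED BLOCK-MEAN PROJECTOR KERNEL
# `piKSymBm ρ N` (field block `[x′ − x ∈ cube]·pmSymBm ρ N β x′ α x`, multiplier block the identity), its decay ∕ `Spr`, block-translation invariance,
# **PERMUTATION INVARIANCE `permK (axisPerm σ) (piKSymBm ρ_c N) = piKSymBm ρ_c N`**, and the co-dressing `coDressKSymAt ρ N K := Π̂_symᵀ ∘ K ∘ Π̂_sym`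
# (verbatim port of `AxialDressingRootedBmKernel` §1–§2 with `pmBm ↦ pmSymBm`)

HONEST FRAMING (cell contract, verbatim): «discharging `BetaPertH` makes Bałaban's UV stability UNCONDITIONAL — a real constructive-QFT
result; it is NOT the continuum limit and NOT the Clay problem.»  THIS MODULE DISCHARGES NOTHING of `BetaPertH` ∕ row D1: [folklore] kernel
bookkeeping of OUR projector (the cell's `MKer`∕`comp`∕`Decays` currency).  0 sorry, 0 `def … : Prop`, nothing cited.

WHAT (JSB12SYM-SPINE v1.1 (Σ2), RULING R-D1-g25-1): the co-dressed resolvents of the re-based literal «JsB12Sym» are `coDressKSymAt (ctr) n (KInvStep …)` —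
the comb's `coDressKBmAt` with the symmetrised block-mean projector.  This file is the kernel layer: definition, entry lemmas, column contraction, decay at
every rate (window + the bound of part 1), `Spr`, `shiftK`-invariance (part 1's `pmSymBm_shift`), the NEW `permK`-invariance at the centred root (part 1's
`pmSymBm_perm`; the window `cube` is permutation-invariant), and the co-dressing with `comp_piKSymBm_inr`, `decays_coDressKSymAt`, `spr_coDressKSymAt`,
`shiftK_coDressKSymAt`, **`permK_coDressKSymAt`** (co-dressing a permutation-invariant kernel gives a permutation-invariant kernel — the hP-dress feed for the
dressing, R-D1-g25-2 (2)).  NOT HERE: reflections at kernel level (`refK`, pattern `AxialDressingRootedBmKernel` §3 — next), the slice projector `symE` (K1-b),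
`RelInv` (K2).  NOT D1, NOT BetaPertH, NOT continuum, NOT Clay.
CHART (RULING R-D1-g25-4): chart (II) — the FIXED κ = 0 slice `ker G_sym` with the block-orthogonal `symE`; the slice-exchange row hSX
(`R_SX`, an3-g46 THEOREM R, `b2b-balaban-beta-an3/gen46/FP-SYM.v1.md`) is a SEPARATE displayed binder of the literal and is NOT in this file.
HONEST DEPENDENCY (verbatim): «continuum YM on T⁴ ⇐ BetaPertH ∧ nine spine estimates (0/9 proved); BetaPertH ⇐ (D1) ∧ (D4) ∧ CAP+tail;
G-an2-4 gates asym, D1 and NE2/3/4.»  ABSOLUTE RULE (cell, verbatim): «No internally-minted statement may enter as a cited fact. Every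
hypothesis is either kernel-proved in this package or a verbatim quotation of a PUBLISHED theorem with page reference.»
Unit `b2b-balaban-beta-an2` gen 25 (row-D1 owner), 2026-08-21.
-/

namespace Summit.QuantumFields.BalabanUV.Beta.SymmetrisedDressingKernel

noncomputable section

open Finset
open scoped BigOperators Nat
open Literature.MathematicalPhysics.QuantumFieldTheory
open Literature.MathematicalPhysics.QuantumFieldTheory.Balaban1983to89
open Literature.MathematicalPhysics.QuantumFieldTheory.Balaban1983to89.Beta
open B12Sec2to5 (l1 l1_nonneg)
open ExpKernelCalculus (MKer Decays comp tr shiftK l1_sub_symm)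
open AffineAveraging (Form0 Form1 Site box toSite unitVec unitVec_apply blockSum)
open AveragingContours (blk grad shift)
open AveragingContoursRooted (ctr ctrOff ctrOff_mem_box)
open OneStepResolventKernel (Fib)
open OneStepKernelFamily (colH)
open Summit.QuantumFields.BalabanUV.Beta.TameKernelCalculus
open Summit.QuantumFields.BalabanUV.Beta.KernelPermutation (psite psite_apply psite_sub permK axisPerm permK_axisPerm_apply axisPerm_π_inl axisPerm_π_inr
  axisPerm_l1)
open Summit.QuantumFields.BalabanUV.Beta.AxialDressingRooted
open Summit.QuantumFields.BalabanUV.Beta.SymmetrisedDressingMatrix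

variable {d : ℕ}

/-! ## §1 The symmetrised block-mean projector kernel `piKSymBm` -/

section PiKSymBm

/-- [our object] **THE SYMMETRISED BLOCK-MEAN PROJECTOR KERNEL** `piKSymBm ρ N`: field block `[x′ − x ∈ cube]·pmSymBm ρ N β x′ α x`, multiplier block the
identity (cf. `AxialDressingRootedBmKernel.piKBm`; as there, the kernel at (row `(x,α)`, column `(x′,β)`) is the matrix element `(Π^{sym}_bm δ_{(α,x)})_β(x′)`, i.e.
`piKSymBm` represents `Π̂ᵀ` and `trK piKSymBm` represents `Π̂` in the cell's operator convention). -/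
def piKSymBm (ρ : Fin (d + 1) → ℤ) (N : ℕ) : MKer (d + 1) (Fib d) :=
  fun x x' a b =>
    match a, b with
    | Sum.inl α, Sum.inl β => if x' - x ∈ cube (d + 1) N then pmSymBm ρ N β x' α x else 0
    | Sum.inl _, Sum.inr _ => 0
    | Sum.inr _, Sum.inl _ => 0
    | Sum.inr m, Sum.inr m' => if x = x' ∧ m = m' then 1 else 0

variable (ρ : Fin (d + 1) → ℤ) (N : ℕ)

/-- [folklore] Field–field entry. -/
theorem piKSymBm_inl_inl (x x' : Fin (d + 1) → ℤ) (α β : Fin (d + 1)) :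
    piKSymBm ρ N x x' (Sum.inl α) (Sum.inl β) = if x' - x ∈ cube (d + 1) N then pmSymBm ρ N β x' α x else 0 := rfl

/-- [folklore] Field–multiplier entry vanishes. -/
theorem piKSymBm_inl_inr (x x' : Fin (d + 1) → ℤ) (α m : Fin (d + 1)) : piKSymBm ρ N x x' (Sum.inl α) (Sum.inr m) = 0 := rfl

/-- [folklore] Multiplier–field entry vanishes. -/
theorem piKSymBm_inr_inl (x x' : Fin (d + 1) → ℤ) (m α : Fin (d + 1)) : piKSymBm ρ N x x' (Sum.inr m) (Sum.inl α) = 0 := rfl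

/-- [folklore] Multiplier–multiplier entry is the identity. -/
theorem piKSymBm_inr_inr (x x' : Fin (d + 1) → ℤ) (m m' : Fin (d + 1)) :
    piKSymBm ρ N x x' (Sum.inr m) (Sum.inr m') = if x = x' ∧ m = m' then 1 else 0 := rfl

/-- [folklore] WITHOUT the window (in-block root): the window is automatic by part 1's support lemma. -/
theorem piKSymBm_inl_inl_eq {N : ℕ} (hN : 1 ≤ N) {r : Fin (d + 1) → ℕ} (hr : r ∈ box (d + 1) N) (x x' : Fin (d + 1) → ℤ) (α β : Fin (d + 1)) :
    piKSymBm (toSite r) N x x' (Sum.inl α) (Sum.inl β) = pmSymBm (toSite r) N β x' α x := by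
  rw [piKSymBm_inl_inl]
  split_ifs with h
  · rfl
  · by_contra h0
    exact h (window_of_pmSymBm_ne_zero hN hr (Ne.symm h0))

/-- [folklore] Column contraction, field column: a windowed `pmSymBm`-sum. -/
theorem sum_piKSymBm_col_inl (u u' : Fin (d + 1) → ℤ) (κ' : Fin (d + 1)) (g : Fib d → ℝ) :
    ∑ f : Fib d, piKSymBm ρ N u u' f (Sum.inl κ') * g f =
      if u' - u ∈ cube (d + 1) N then ∑ κ : Fin (d + 1), pmSymBm ρ N κ' u' κ u * g (Sum.inl κ) else 0 := by
  rw [Fintype.sum_sum_type]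
  simp only [piKSymBm_inl_inl, piKSymBm_inr_inl, zero_mul, Finset.sum_const_zero, add_zero]
  split_ifs
  · rfl
  · simp

/-- [folklore] **`piKSymBm` DECAYS AT EVERY RATE** (in-block root; same constant `cPb` as the comb kernel). -/
theorem decays_piKSymBm {N : ℕ} (hN : 1 ≤ N) {r : Fin (d + 1) → ℕ} (hr : r ∈ box (d + 1) N) {δ : ℝ} (hδ : 0 ≤ δ) :
    Decays (piKSymBm (toSite r) N) (cPb d N δ) δ := by
  intro x x' a b
  have hpos : 0 ≤ cPb d N δ * Real.exp (-δ * l1 (x - x')) := mul_nonneg (cPb_nonneg d N δ) (Real.exp_pos _).le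
  rcases a with α | m <;> rcases b with β | m'
  · rw [piKSymBm_inl_inl]
    split_ifs with h
    · have hl : l1 (x - x') ≤ ((d : ℝ) + 1) * N := by
        rw [l1_sub_symm]
        have := l1_le_of_mem_cube h
        push_cast at this
        exact this
      have hpm := abs_pmSymBm_le hN hr β x' α x
      have hdn : ((d + 1 : ℕ) : ℝ) = (d : ℝ) + 1 := by push_cast; ring
      rw [hdn] at hpm
      have hA : (0 : ℝ) ≤ 1 + 4 * (((d : ℝ) + 1) * N) := by
        have : (0 : ℝ) ≤ ((d : ℝ) + 1) * N := by positivity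
        linarith
      have he : (1 : ℝ) ≤ Real.exp (δ * (((d : ℝ) + 1) * N)) * Real.exp (-δ * l1 (x - x')) := by
        rw [← Real.exp_add]
        exact Real.one_le_exp (by nlinarith)
      calc |pmSymBm (toSite r) N β x' α x| ≤ (1 + 4 * (((d : ℝ) + 1) * N)) * 1 := by rw [mul_one]; exact hpm
        _ ≤ (1 + 4 * (((d : ℝ) + 1) * N)) * (Real.exp (δ * (((d : ℝ) + 1) * N)) * Real.exp (-δ * l1 (x - x'))) :=
            mul_le_mul_of_nonneg_left he hA
        _ = cPb d N δ * Real.exp (-δ * l1 (x - x')) := by unfold cPb; ring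
    · rw [abs_zero]; exact hpos
  · rw [piKSymBm_inl_inr, abs_zero]; exact hpos
  · rw [piKSymBm_inr_inl, abs_zero]; exact hpos
  · rw [piKSymBm_inr_inr]
    split_ifs with h
    · rw [h.1, sub_self, abs_one]
      have h0 : l1 (0 : Fin (d + 1) → ℤ) = 0 := by simp [l1]
      rw [h0, mul_zero, Real.exp_zero, mul_one]
      exact one_le_cPb d N hδ
    · rw [abs_zero]; exact hpos

/-- [folklore] `piKSymBm` is spread. -/
theorem spr_piKSymBm {N : ℕ} (hN : 1 ≤ N) {r : Fin (d + 1) → ℕ} (hr : r ∈ box (d + 1) N) : Spr (piKSymBm (toSite r) N) :=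
  ⟨cPb d N 1, 1, one_pos, decays_piKSymBm hN hr zero_le_one⟩

/-- [folklore] So is its transpose. -/
theorem spr_trK_piKSymBm {N : ℕ} (hN : 1 ≤ N) {r : Fin (d + 1) → ℕ} (hr : r ∈ box (d + 1) N) : Spr (trK (piKSymBm (toSite r) N)) :=
  (spr_piKSymBm hN hr).trK

/-- [folklore] `piKSymBm` is block-translation invariant. -/
theorem shiftK_piKSymBm (ρ : Fin (d + 1) → ℤ) {N : ℕ} (hN : 1 ≤ N) (t : Fin (d + 1) → ℤ) :
    shiftK (-((N : ℤ) • t)) (piKSymBm ρ N) = piKSymBm ρ N := by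
  funext x x' a b
  show piKSymBm ρ N (x + -((N : ℤ) • t)) (x' + -((N : ℤ) • t)) a b = piKSymBm ρ N x x' a b
  rcases a with α | m <;> rcases b with β | m'
  · rw [piKSymBm_inl_inl, piKSymBm_inl_inl, add_sub_add_right_eq_sub,
      show -((N : ℤ) • t) = (N : ℤ) • (-t) from (smul_neg _ _).symm, pmSymBm_shift ρ hN]
  · rfl
  · rfl
  · rw [piKSymBm_inr_inr, piKSymBm_inr_inr]
    simp only [add_left_inj]

/-- [folklore] The window is permutation-invariant. -/
theorem psite_mem_cube_iff (σ : Equiv.Perm (Fin (d + 1))) (N : ℕ) (v : Fin (d + 1) → ℤ) : psite σ v ∈ cube (d + 1) N ↔ v ∈ cube (d + 1) N := by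
  rw [mem_cube, mem_cube]
  constructor
  · intro h i; simpa [psite_apply] using h (σ i)
  · intro h i; rw [psite_apply]; exact h _

/-- [folklore] **`piKSymBm` AT THE CENTRED ROOT IS PERMUTATION-INVARIANT**: `permK (axisPerm σ) (piKSymBm ρ_c N) = piKSymBm ρ_c N` — the kernel-level
form of part 1's `pmSymBm_perm` (the comb kernel `piKBm` has no such law). -/
theorem permK_piKSymBm (σ : Equiv.Perm (Fin (d + 1))) (N : ℕ) : permK (axisPerm σ) (piKSymBm (ctr (d + 1) N) N) = piKSymBm (ctr (d + 1) N) N := by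
  funext x x' a b
  rw [permK_axisPerm_apply]
  rcases a with α | m <;> rcases b with β | m'
  · rw [axisPerm_π_inl, axisPerm_π_inl, piKSymBm_inl_inl, piKSymBm_inl_inl, ← psite_sub]
    by_cases h : x' - x ∈ cube (d + 1) N
    · rw [if_pos ((psite_mem_cube_iff σ N _).2 h), if_pos h, pmSymBm_perm]
    · rw [if_neg (fun h' => h ((psite_mem_cube_iff σ N _).1 h')), if_neg h]
  · rw [axisPerm_π_inl, axisPerm_π_inr, piKSymBm_inl_inr, piKSymBm_inl_inr]
  · rw [axisPerm_π_inr, axisPerm_π_inl, piKSymBm_inr_inl, piKSymBm_inr_inl]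
  · rw [axisPerm_π_inr, axisPerm_π_inr, piKSymBm_inr_inr, piKSymBm_inr_inr]
    simp only [EmbeddingLike.apply_eq_iff_eq, (psite σ).injective.eq_iff]

end PiKSymBm

/-! ## §2 The co-dressed kernel -/

section Comp

variable (ρ : Fin (d + 1) → ℤ) (N : ℕ)

/-- [our object] **THE SYMMETRISED DRESSING OF A KERNEL** (comp form): `dressKSymAt ρ N K := piKSymBm∘K∘piKSymBmᵀ`. -/
def dressKSymAt (K : MKer (d + 1) (Fib d)) : MKer (d + 1) (Fib d) := comp (comp (piKSymBm ρ N) K) (trK (piKSymBm ρ N))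

/-- [our object] **THE SYMMETRISED CO-DRESSED KERNEL** `coDressKSymAt ρ N K := piKSymBmᵀ∘K∘piKSymBm` (= `Π̂_sym K Π̂_symᵀ` in operator convention). -/
def coDressKSymAt (K : MKer (d + 1) (Fib d)) : MKer (d + 1) (Fib d) := comp (comp (trK (piKSymBm ρ N)) K) (piKSymBm ρ N)

/-- [folklore] `coDressKSymAt` unfolds. -/
theorem coDressKSymAt_eq (K : MKer (d + 1) (Fib d)) : coDressKSymAt ρ N K = comp (comp (trK (piKSymBm ρ N)) K) (piKSymBm ρ N) := rfl

/-- [folklore] Right composition with `piKSymBm` does not touch a multiplier column. -/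
theorem comp_piKSymBm_inr (A : MKer (d + 1) (Fib d)) (x y : Fin (d + 1) → ℤ) (a : Fib d) (μ : Fin (d + 1)) :
    comp A (piKSymBm ρ N) x y a (Sum.inr μ) = A x y a (Sum.inr μ) := by
  unfold ExpKernelCalculus.comp
  have h : ∀ y', ∑ f : Fib d, A x y' a f * piKSymBm ρ N y' y f (Sum.inr μ) = if y' = y then A x y' a (Sum.inr μ) else 0 := by
    intro y'
    rw [Fintype.sum_sum_type]
    simp only [piKSymBm_inl_inr, piKSymBm_inr_inr, mul_zero, Finset.sum_const_zero, zero_add]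
    by_cases hy : y' = y
    · simp only [hy, true_and, mul_ite, mul_one, mul_zero, Finset.sum_ite_eq', Finset.mem_univ, if_true]
    · simp [hy]
  simp_rw [h]
  rw [tsum_point']

/-- [folklore] The `ℋ`-column of the co-dressed kernel is the windowed `Π^{sym}_bm`-image of the `ℋ`-column of `K`. -/
theorem colH_coDressKSymAt (K : MKer (d + 1) (Fib d)) (μ : Fin (d + 1)) (y : Fin (d + 1) → ℤ) (κ' : Fin (d + 1)) (u' : Fin (d + 1) → ℤ) :
    colH (coDressKSymAt ρ N K) N μ y κ' u' =
      ∑ v ∈ cube (d + 1) N, ∑ κ : Fin (d + 1), pmSymBm ρ N κ' u' κ (u' - v) * colH K N μ y κ (u' - v) := by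
  unfold colH
  rw [coDressKSymAt_eq, comp_piKSymBm_inr]
  unfold ExpKernelCalculus.comp
  simp only [trK]
  have h : ∀ u, ∑ f : Fib d, piKSymBm ρ N u u' f (Sum.inl κ') * K u ((N : ℤ) • y) f (Sum.inr μ) =
      if u' - u ∈ cube (d + 1) N then
        ∑ κ : Fin (d + 1), pmSymBm ρ N κ' u' κ u * K u ((N : ℤ) • y) (Sum.inl κ) (Sum.inr μ) else 0 := fun u =>
    sum_piKSymBm_col_inl ρ N u u' κ' (fun f => K u ((N : ℤ) • y) f (Sum.inr μ))
  simp_rw [h]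
  rw [tsum_window']

/-- [folklore] The co-dressed kernel decays (in-block root). -/
theorem decays_coDressKSymAt {N : ℕ} (hN : 1 ≤ N) {r : Fin (d + 1) → ℕ} (hr : r ∈ box (d + 1) N)
    {K : MKer (d + 1) (Fib d)} (hK : ∃ δ C : ℝ, 0 < δ ∧ 0 ≤ C ∧ Decays K C δ) :
    ∃ δ C : ℝ, 0 < δ ∧ 0 ≤ C ∧ Decays (coDressKSymAt (toSite r) N K) C δ := by
  obtain ⟨δ, C, hδ, -, hK⟩ := hK
  have hPt : Decays (trK (piKSymBm (toSite r) N)) (cPb d N δ) δ := decays_trK (decays_piKSymBm hN hr hδ.le)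
  have h1 := BalabanStepJetsSucc.decays_comp hPt hK (show 0 ≤ δ / 2 by linarith) (show δ / 2 < δ by linarith)
  have hP : Decays (piKSymBm (toSite r) N) (cPb d N (δ / 2)) (δ / 2) := decays_piKSymBm hN hr (by linarith)
  have h2 := BalabanStepJetsSucc.decays_comp h1 hP (show 0 ≤ δ / 4 by linarith) (show δ / 4 < δ / 2 by linarith)
  exact ⟨δ / 4, _, by linarith, h2.nonneg (Sum.inl 0), h2⟩

/-- [folklore] The co-dressed kernel of a spread kernel is spread. -/
theorem spr_coDressKSymAt {N : ℕ} (hN : 1 ≤ N) {r : Fin (d + 1) → ℕ} (hr : r ∈ box (d + 1) N) {K : MKer (d + 1) (Fib d)} (hK : Spr K) :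
    Spr (coDressKSymAt (toSite r) N K) :=
  spr_comp (spr_comp (spr_trK_piKSymBm hN hr) hK) (spr_piKSymBm hN hr)

/-- [folklore] Block-translation covariance of the co-dressed kernel. -/
theorem shiftK_coDressKSymAt (ρ : Fin (d + 1) → ℤ) {N : ℕ} (hN : 1 ≤ N) {K : MKer (d + 1) (Fib d)}
    (hKs : ∀ t : Fin (d + 1) → ℤ, shiftK (-((N : ℤ) • t)) K = K) (t : Fin (d + 1) → ℤ) :
    shiftK (-((N : ℤ) • t)) (coDressKSymAt ρ N K) = coDressKSymAt ρ N K := by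
  rw [coDressKSymAt_eq, ← ExpKernelCalculus.comp_shiftK, ← ExpKernelCalculus.comp_shiftK, ← trK_shiftK, shiftK_piKSymBm ρ hN, hKs]

/-- [folklore] `permK` commutes with the kernel transpose. -/
theorem permK_trK {D : ℕ} {F : Type*} [Fintype F] (Ψ : KernelPermutation.LegPerm D F) (K : MKer D F) : permK Ψ (trK K) = trK (permK Ψ K) := rfl

/-- [folklore] **PERMUTATION INVARIANCE OF THE CO-DRESSED KERNEL** at the centred root: if `permK (axisPerm σ) K = K` (e.g. `KInv`, `KInvStep j`:
`ResolventPermutation.permK_KInv`, `ResolventPermutationStep.permK_KInvStep`), then `permK (axisPerm σ) (coDressKSymAt ρ_c N K) = coDressKSymAt ρ_c N K`. -/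
theorem permK_coDressKSymAt (σ : Equiv.Perm (Fin (d + 1))) (N : ℕ) {K : MKer (d + 1) (Fib d)} (hK : permK (axisPerm σ) K = K) :
    permK (axisPerm σ) (coDressKSymAt (ctr (d + 1) N) N K) = coDressKSymAt (ctr (d + 1) N) N K := by
  have hP := permK_piKSymBm σ N
  have hT : permK (axisPerm σ) (trK (piKSymBm (ctr (d + 1) N) N)) = trK (piKSymBm (ctr (d + 1) N) N) := by rw [permK_trK, hP]
  rw [coDressKSymAt_eq, ← KernelPermutation.comp_permK, ← KernelPermutation.comp_permK, hT, hK, hP]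

end Comp

end

end Summit.QuantumFields.BalabanUV.Beta.SymmetrisedDressingKernel
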